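import Summits.QuantumFields.YangMills.Theorems.BalabanUVNodesN17AtRateRecord12
import Summits.QuantumFields.YangMills.Theorems.BalabanUVNodesRateCarriersOfRecord12On
import Summits.QuantumFields.YangMills.Theorems.BalabanUVNodesRateReadingOfRecord12
import Literature.MathematicalPhysics.QuantumFieldTheory.Balaban1983to89.Node00.Record12DatumKeyCN

/-!
# BalabanUVNodes ∕ node N17 = NE4 AT THE REGIME-RESTRICTED, TUPLE-KEYED STAGE-12 RATE-RECORD HOME `YMDAG.UVSplit.RRec₁₂On 𝔯 Rg` (dag-n22-e (T-RATE)
# module 5, p468431) — the `h17 : S_N17 (RRec₁₂On 𝔯 (Node00.unityNondeg₁₂ 2))` the K3′ composer of record reads (dag-n27-c XXVI `spineGivenEndpointR12_of_homes₁₂On`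
# ∕ `…_of_homes₁₂CN`, XXVIII `forall_guarded₁₂_of_homes₁₂On`): the stub READ level-free AT THE TUPLE, its one-application closers with the in-edges N15 ∕ N16 ∕ N18 ∕ (D4)
# as hypotheses BY NAME, its transfers, its faces at the NAMED reading of record, and N17's ∀-form at node00-def-RR-2's regime record classes `IsRecordOfRecord₁₂COn ∕ CN`

Cell `pub-ymgap`, HUMAN RULING D-0062, seat `pub-ymgap-dag-n17-c` (R134 fan-out, strategy s2), generation 5; companion 19 (§55–§59) of `BalabanUVNodesN17Knit` … `…N17AtRecord12Carriers`
(companion 18).  THEOREMS ONLY; imports companion 16 `…N17AtRateRecord12` (N17 at the CANONICAL home `RRec₁₂ 𝔯`; brings companions 13∕15: `n17At_u3OfRecord₁₂_iff`,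
`n17At_u3OfRecord₁₂_datumOfRecord₁₂_iff`, `N17_datumOfRecord₁₂_iff_betaOfRecord₁₀`, `N17_datumOfRecord₁₂_iff_merged`, `N17_datumOfRecord₁₂_of_kernelStepRate`, `N17_iff_of_isRateKey₁₂`,
`scaleShiftRate_mono_const`, `YMDAG.N17.s_N17_of_D4_N18`, `YMDAG.N17.n17At_of_readOutAt`), n22-e's module 5 `…RateCarriersOfRecord12On` (`RRec₁₂On`, `s_N17_rRec₁₂On_iff`, `k4_rRec₁₂On_anti`,
`k4_rRec₁₂_of_rRec₁₂On_true`, `rRec₁₂On_of_regime_params`) and module 6 `…RateReadingOfRecord12` (`readingOfRecord₁₂ w1 ℓ₃ ne2 ne1`, `readingOfRecord₁₂_u3`), node00-def-RR-2's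
`Node00/Record12DatumKeyCN` (`unityNondeg₁₂`, `IsRecordOfRecord₁₂COn ∕ CN`, `IsRateKey₁₂`; p470951); modifies nothing; every cited lemma used BY NAME.  `N`-generic and `Rg`-generic —
n27-c instantiates `N = 2`, `Rg := fun F θ => θ.ZtUnity F 2 ∧ θ.SlotsNondegenerate = Node00.unityNondeg₁₂ 2`.

THE POINT.  `RRec₁₂On 𝔯 Rg F D g₀ os R :↔ ∃ θ hP, Rg F θ ∧ θ.Admissible F N ∧ D = datumOfRecord₁₂ F N θ hP ∧ ∃ k, R = rateCarriersOfRecord₁₂ 𝔯 F θ hP g₀ os k` — the bundle is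
read AT THE TUPLE θ on θ's OWN datum (not at the canonical parameter `h.params` of a datum key, as at `RRec₁₂ 𝔯`).  Since N17 reads node U3's bundle only through the K-uniform
letters `(cr·C₅·θ₅, ρ)` and the window radius `θ.γ` (`n17At_u3OfRecord₁₂_iff`, `Iff.rfl`), and the Stage-12 datum's β is the definer's assembly line `βmT(θ)` on `]0, θ.γ]`
(companion 13), the stub at the On home IS — as an `iff`, not merely a closer — THE GUARDED ∀θ SENTENCE THE ESTIMATE SEATS WORK IN:
* §55 **`s_N17_rRec₁₂On_iff_merged`**: `S_N17 (RRec₁₂On 𝔯 Rg) ⟺ ∀ F θ hP, Rg F θ → θ.Admissible F N → ∀ g₀ os, ScaleShiftRate (cr·C₅·θ₅) ρ θ.γ βmT(θ)` at the letters of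
  `(𝔯.lit F θ hP g₀ os).u3`; `…_iff_betaOfRecord₁₀` (same about `betaOfRecord₁₀ θ.toStage9Params`); `…_unityNondeg_iff_merged` (at RR-2's guard of record = n27-c's `h17`).
* §56 ONE-APPLICATION CLOSERS (the in-edges as hypotheses BY NAME, guarded): `s_N17_rRec₁₂On_of_forall_guarded` · `…_of_split` ((AF-0r) for `beta0OfRecord₁₁ (θ.toStage11 p)` =
  N15's currency + `RemainderShiftRate (oneLoopSplitOfRecord₁₁ (θ.toStage11 p))` = N16 ∕ N18's, `2c₀ + c₁ ≤ cr·C₅·θ₅`) · `…_of_s_D4_s_N18` (U3 road `S_D4 → S_N18 → S_N17` at the On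
  home = `YMDAG.N17.s_N17_of_D4_N18` verbatim) · `…_of_readOut_ne5_forall_guarded` (its ∀θ face) · `…_of_kernelStepRate_forall_guarded` ((UD) + history-matched step rate of the
  record's own `polLimit` kernels, `betaPrime510 4 C′ δ′ ≤ cr·C₅·θ₅`) · conversely `af0r_of_s_N17_rRec₁₂On` (what the stub DELIVERS at each guarded tuple: (AF-0r) for the tuple's
  own `beta0OfMerged βmT(θ) θ.v₀` — K2′'s `hconv` input — and the merged remainder's rate, constants degraded by `1∕(1 − ρ)`).
* §57 TRANSFERS: `s_N17_rRec₁₂On_anti` (antitone in the regime) · `s_N17_rRec₁₂_of_rRec₁₂On_true` (On home at ⊤ ⟹ canonical home) · `s_N17_rRec₁₂On_of_rRec₁₂On_true` ·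
  `s_N17_rRec₁₂_of_rRec₁₂On_of_regime_params` · `s_N17_rRec₁₂On_unityNondeg_of_ztUnity` (unity regime ⟹ guard of record) · `s_N17_rRec₁₂On_of_guard_empty` (R422 vacuity face).
  NOT CLAIMED: canonical home ⟹ On home — N17 reads the TUPLE's window radius and the letters AT the tuple; two tuples with one datum need not share them.
* §58 AT THE NAMED READINGS — any W1-assignment reading `RateReading₁₂.ofAssignment (W1.assignment₁₂ 𝔇) ne1` (n18-d's `𝔯_W1`): `s_N17_rRec₁₂On_w1Assignment_iff_merged`;
  the reading of record `readingOfRecord₁₂ w1 ℓ₃ ne2 ne1` (node U3's objects := W1's `(w1 F θ).u3Objects θ.γ`, `rfl`): `s_N17_rRec₁₂On_readingOfRecord₁₂_iff_merged` (`g₀`, `os`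
  IDLE — one sentence per guarded tuple about W1's analytic-block letters) and the canonical-home twin `s_N17_readingOfRecord₁₂_iff_merged`.
* §59 N17's ∀-FORM AT RR-2's REGIME RECORD CLASSES: `N17_of_isRecordOfRecord₁₂COn` ∕ `N17_iff_forall_of_isRecordOfRecord₁₂COn` ∕ `N17_of_isRecordOfRecord₁₂CN` (the estimate asked only
  of tuples IN THE REGIME realising `D`, box `w.γ ≤ θ.γ`; companion 13 §44's ₁₂C faces with the guard available) · `s_N17_of_rec₁₂COn` ((W2) closer for an `RRec` home keyed to the
  regime record class).

HONEST FRAMING.  Kernel bookkeeping BY NAME; 0 `sorry`; 0 `def`; NE4 NOT IN PRINT ([Balaban1987RG1] (1.20)–(1.22) p. 264: η-rate of the FULL β_k — «defined on the interval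
[0, γ]») and NOT PROVED; every rate input ((AF-0r), remainder rate, (D4), NE5, (UD), step rate) is a DISPLAYED hypothesis with no producer at a named reading today; the reading
`𝔯` RESIDUAL except where §58 names it; no inhabitant of any key claimed (K0′ `Record12Inhabited`, stmt-QuantumFields-19902, open) — the stubs at the On home are NOT vacuous by
construction and §57's vacuity face says exactly when they would be; N17 = composite (max of N15, N16, (D4)), NOT discharged; counts UNMOVED (typed 28∕28 · discharged 5∕27,
A 5∕28).  One finite four-torus at fixed ε per run — NOT ℝ⁴, NOT infinite volume, NOT OS, NOT a mass gap, NOT Clay.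
-/

noncomputable section

open scoped Matrix.Norms.L2Operator

namespace Summit.QuantumFields.YangMills.Theorems.BalabanUVNodesN17

open Literature.MathematicalPhysics.QuantumFieldTheory.Balaban1983to89
open Literature.MathematicalPhysics.QuantumFieldTheory.Balaban1983to89.FlowStep
open Literature.MathematicalPhysics.QuantumFieldTheory.Balaban1983to89.T4CouplingMatching
open Literature.MathematicalPhysics.QuantumFieldTheory.Balaban1983to89.T4Continuum (T4Family FiniteEpsData ULoop)
open Literature.MathematicalPhysics.QuantumFieldTheory.Balaban1983to89.B12Sec2to5 (Decay510 betaPrime510)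
open Literature.MathematicalPhysics.QuantumFieldTheory.Balaban1983to89.Beta.LimitRate (subKernel)
open Literature.MathematicalPhysics.QuantumFieldTheory.Balaban1983to89.Node00
open Literature.MathematicalPhysics.QuantumFieldTheory.Balaban1983to89.DagBinding (WorldP)
open Summit.QuantumFields.BalabanUV.T4Continuum.Spine.NE4 (NE4OnData ne4OnData_iff)
open YMDAG.UVSplit (Datum U3Carriers RateCarriers RateRecordPred NE1pCarriers N17At N18At ReadOutAt S_N17 S_N18 S_D4 RateReading₁₂ RRec₁₂ RRec₁₂On u3OfRecord₁₂
  rateCarriersOfRecord₁₂ readingOfRecord₁₂ s_N17_rRec₁₂_iff s_N17_rRec₁₂On_iff k4_rRec₁₂On_anti k4_rRec₁₂_of_rRec₁₂On_true rRec₁₂On_of_regime_params)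

variable {F : T4Family} {N : ℕ} [NeZero N]

variable (𝔯 : RateReading₁₂ N) (Rg : (F : T4Family) → Stage12Params F N → Prop)

/-! ## §55 THE STUB `S_N17 (RRec₁₂On 𝔯 Rg)` READ: the guarded ∀θ merged-β sentence, level-free, AT THE TUPLE -/

/-- **THE K4 STUB `S_N17` AT THE REGIME-RESTRICTED HOME IS THE GUARDED ∀θ SENTENCE ABOUT THE CONTINUOUS-VERSION MERGED β OF THE TUPLE ITSELF**:
`S_N17 (RRec₁₂On 𝔯 Rg)` ⟺ for every family, every Stage-12 tuple `θ` with provisos `hP` IN THE REGIME `Rg F θ` and admissible, every `g₀, os`: the scale-shift rate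
`ScaleShiftRate (cr·C₅·θ₅) ρ θ.γ βmT(θ)` at the letters of the reading's U3 objects `(𝔯.lit F θ hP g₀ os).u3` — n22-e's `s_N17_rRec₁₂On_iff` with the run length eliminated
(`n17At_u3OfRecord₁₂_iff`, `Iff.rfl`) and the datum `datumOfRecord₁₂ F N θ hP` read through companion 16's `n17At_u3OfRecord₁₂_datumOfRecord₁₂_iff` (companion 13's
`n17At_datumOfRecord₁₂_iff_merged`).  Unlike the canonical
home `RRec₁₂ 𝔯` (companion 16 `s_N17_rRec₁₂_iff_merged`: only the canonical parameter of each datum key is read), at the On home the stub IS the estimate seats' ∀θ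
currency verbatim.  NE4 NOT IN PRINT; `𝔯` RESIDUAL. [cite: Balaban1987RG1, (1.20)-(1.22) p.264] -/
theorem s_N17_rRec₁₂On_iff_merged :
    S_N17 (RRec₁₂On 𝔯 Rg) ↔ ∀ (F : T4Family) (θ : Stage12Params F N) (hP : θ.Provisos₁₂ F N), Rg F θ → θ.Admissible F N →
      ∀ (g₀ : ℕ → ℝ) (os : List (ULoop F)),
      letI := θ.instVβ₁; letI := θ.instVβ₂; letI := θ.instιβ
      ScaleShiftRate ((𝔯.lit F θ hP g₀ os).u3.cr * (𝔯.lit F θ hP g₀ os).u3.C₅ * (𝔯.lit F θ hP g₀ os).u3.θ₅) (𝔯.lit F θ hP g₀ os).u3.ρ θ.γ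
        (betaMerged F (mergedTermFamilyMatT F N (TcOfRecord F N) (chiFixed7 F N θ.ν) θ.εbg) θ.ρ8 θ.bV) := by
  rw [s_N17_rRec₁₂On_iff]
  constructor
  · intro hS F θ hP hRg hθ g₀ os
    exact (n17At_u3OfRecord₁₂_datumOfRecord₁₂_iff θ hP _ 0).mp (hS F θ hP hRg hθ g₀ os 0)
  · intro hin F θ hP hRg hθ g₀ os k
    exact (n17At_u3OfRecord₁₂_datumOfRecord₁₂_iff θ hP _ k).mpr (hin F θ hP hRg hθ g₀ os)

/-- **… OR ABOUT def-T's β OF RECORD `betaOfRecord₁₀ θ.toStage9Params` OF THE TUPLE** (`= (datumOfRecord₁₂ F N θ hP).βfun`; companion 13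
`N17_datumOfRecord₁₂_iff_betaOfRecord₁₀`, `Iff.rfl`): the same guarded ∀θ sentence with no box bookkeeping. [cite: Balaban1987RG1, (1.20)-(1.22) p.264] -/
theorem s_N17_rRec₁₂On_iff_betaOfRecord₁₀ :
    S_N17 (RRec₁₂On 𝔯 Rg) ↔ ∀ (F : T4Family) (θ : Stage12Params F N) (hP : θ.Provisos₁₂ F N), Rg F θ → θ.Admissible F N →
      ∀ (g₀ : ℕ → ℝ) (os : List (ULoop F)),
      ScaleShiftRate ((𝔯.lit F θ hP g₀ os).u3.cr * (𝔯.lit F θ hP g₀ os).u3.C₅ * (𝔯.lit F θ hP g₀ os).u3.θ₅) (𝔯.lit F θ hP g₀ os).u3.ρ θ.γ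
        (betaOfRecord₁₀ F N θ.toStage9Params) := by
  rw [s_N17_rRec₁₂On_iff]
  constructor
  · intro hS F θ hP hRg hθ g₀ os
    exact (N17_datumOfRecord₁₂_iff_betaOfRecord₁₀ θ hP _ _ _).mp ((n17At_u3OfRecord₁₂_iff _ θ _ 0).mp (hS F θ hP hRg hθ g₀ os 0))
  · intro hin F θ hP hRg hθ g₀ os k
    exact (n17At_u3OfRecord₁₂_iff _ θ _ k).mpr ((N17_datumOfRecord₁₂_iff_betaOfRecord₁₀ θ hP _ _ _).mpr (hin F θ hP hRg hθ g₀ os))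

/-- **AT node00-def-RR-2's GUARD OF RECORD `Node00.unityNondeg₁₂ N`** (`= fun F θ => θ.ZtUnity F N ∧ θ.SlotsNondegenerate`; n27-c's `h17` at `N = 2`): the stub IS «for every
Stage-12 tuple with provisos, print's partition of unity AND non-degenerate present slots, admissible: the `βmT(θ)` rate at the reading's letters on `]0, θ.γ]`».
[cite: Balaban1987RG1, (1.20)-(1.22) p.264] -/
theorem s_N17_rRec₁₂On_unityNondeg_iff_merged :
    S_N17 (RRec₁₂On 𝔯 (unityNondeg₁₂ N)) ↔ ∀ (F : T4Family) (θ : Stage12Params F N) (hP : θ.Provisos₁₂ F N),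
      θ.ZtUnity F N ∧ θ.SlotsNondegenerate → θ.Admissible F N → ∀ (g₀ : ℕ → ℝ) (os : List (ULoop F)),
      letI := θ.instVβ₁; letI := θ.instVβ₂; letI := θ.instιβ
      ScaleShiftRate ((𝔯.lit F θ hP g₀ os).u3.cr * (𝔯.lit F θ hP g₀ os).u3.C₅ * (𝔯.lit F θ hP g₀ os).u3.θ₅) (𝔯.lit F θ hP g₀ os).u3.ρ θ.γ
        (betaMerged F (mergedTermFamilyMatT F N (TcOfRecord F N) (chiFixed7 F N θ.ν) θ.εbg) θ.ρ8 θ.bV) :=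
  s_N17_rRec₁₂On_iff_merged 𝔯 _

/-! ## §56 THE ONE-APPLICATION CLOSERS OF `S_N17 (RRec₁₂On 𝔯 Rg)` — the in-edges BY NAME as guarded hypotheses -/

/-- **THE ONE-APPLICATION CLOSER (guarded ∀θ estimate ⟹ the stub)**: the `βmT(θ)` rate at the reading's letters on `]0, θ.γ]` for every admissible tuple with provisos IN THE
REGIME — the shape an estimate seat proves (NE4 = rows NE2 ∕ NE3 ∕ (D4) composed, NOT IN PRINT) — gives `S_N17 (RRec₁₂On 𝔯 Rg)` (§55, `mpr`). [cite: Balaban1987RG1, (1.20)-(1.22) p.264] -/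
theorem s_N17_rRec₁₂On_of_forall_guarded
    (hin : ∀ (F : T4Family) (θ : Stage12Params F N) (hP : θ.Provisos₁₂ F N), Rg F θ → θ.Admissible F N → ∀ (g₀ : ℕ → ℝ) (os : List (ULoop F)),
      letI := θ.instVβ₁; letI := θ.instVβ₂; letI := θ.instιβ
      ScaleShiftRate ((𝔯.lit F θ hP g₀ os).u3.cr * (𝔯.lit F θ hP g₀ os).u3.C₅ * (𝔯.lit F θ hP g₀ os).u3.θ₅) (𝔯.lit F θ hP g₀ os).u3.ρ θ.γ
        (betaMerged F (mergedTermFamilyMatT F N (TcOfRecord F N) (chiFixed7 F N θ.ν) θ.εbg) θ.ρ8 θ.bV)) :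
    S_N17 (RRec₁₂On 𝔯 Rg) :=
  (s_N17_rRec₁₂On_iff_merged 𝔯 Rg).mpr hin

/-- **THE SPLIT ROAD AT THE REGIME-RESTRICTED HOME** («β⁰ conv + β¹ shift» through the printed split of record READ AT THE VIEW `θ.toStage11 F N p` of the tuple itself, any
run `p`): if for every admissible tuple with provisos in the regime, every `g₀, os`, the letters `u := (𝔯.lit F θ hP g₀ os).u3` have `0 ≤ u.ρ ≤ 1` and there are a run `p`
and constants `c₀ ≥ 0`, `c₁` with `2c₀ + c₁ ≤ u.cr·u.C₅·u.θ₅`, (AF-0r) `|beta0OfRecord₁₁ (θ.toStage11 p) k − β⁰_∞| ≤ c₀·u.ρ^k` (N15 ∕ NODE O's currency) and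
`RemainderShiftRate (oneLoopSplitOfRecord₁₁ (θ.toStage11 p)) c₁ u.ρ θ.γ` (N16 ∕ N18's), then `S_N17 (RRec₁₂On 𝔯 Rg)` (`T4CouplingMatching.scaleShiftRate_of_split` at the split
of record, monotonicity in the constant).  Both binders UNPRINTED, displayed. [cite: Balaban1987RG1, (2.12)-(2.14) p.268] -/
theorem s_N17_rRec₁₂On_of_split
    (hin : ∀ (F : T4Family) (θ : Stage12Params F N) (hP : θ.Provisos₁₂ F N), Rg F θ → θ.Admissible F N → ∀ (g₀ : ℕ → ℝ) (os : List (ULoop F)),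
      0 ≤ (𝔯.lit F θ hP g₀ os).u3.ρ ∧ (𝔯.lit F θ hP g₀ os).u3.ρ ≤ 1 ∧
      ∃ (p : B12.RunParams) (binf c₀ c₁ : ℝ), 0 ≤ c₀ ∧
        2 * c₀ + c₁ ≤ (𝔯.lit F θ hP g₀ os).u3.cr * (𝔯.lit F θ hP g₀ os).u3.C₅ * (𝔯.lit F θ hP g₀ os).u3.θ₅ ∧
        (∀ k, |beta0OfRecord₁₁ F N (θ.toStage11 F N p) k - binf| ≤ c₀ * (𝔯.lit F θ hP g₀ os).u3.ρ ^ k) ∧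
        RemainderShiftRate (oneLoopSplitOfRecord₁₁ F N (θ.toStage11 F N p)) c₁ (𝔯.lit F θ hP g₀ os).u3.ρ θ.γ) :
    S_N17 (RRec₁₂On 𝔯 Rg) := by
  rw [s_N17_rRec₁₂On_iff]
  intro F θ hP hRg hθ g₀ os k
  obtain ⟨hρ0, hρ1, p, binf, c₀, c₁, hc₀, hcc, hconv, hrem⟩ := hin F θ hP hRg hθ g₀ os
  rw [n17At_u3OfRecord₁₂_iff, N17_datumOfRecord₁₂_iff_betaOfRecord₁₀]
  exact scaleShiftRate_mono_const hcc hρ0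
    (scaleShiftRate_of_split (oneLoopSplitOfRecord₁₁ F N (θ.toStage11 F N p)) hρ0 hρ1 hc₀ hconv hrem)

/-- **THE U3 ROAD AT THE REGIME-RESTRICTED HOME, BY NAME**: `S_D4 (RRec₁₂On 𝔯 Rg) → S_N18 (RRec₁₂On 𝔯 Rg) → S_N17 (RRec₁₂On 𝔯 Rg)` — companion `…N17AtSpineCarriers`'
refinement-generic `YMDAG.N17.s_N17_of_D4_N18` at the On home (N22 idle): n27-c's `h17` from `hD4` and `h18` at the SAME regime. [cite: Balaban1987RG1, (1.20)-(1.22) p.264] -/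
theorem s_N17_rRec₁₂On_of_s_D4_s_N18 (hD4 : S_D4 (RRec₁₂On 𝔯 Rg)) (h18 : S_N18 (RRec₁₂On 𝔯 Rg)) : S_N17 (RRec₁₂On 𝔯 Rg) :=
  YMDAG.N17.s_N17_of_D4_N18 (RRec₁₂On 𝔯 Rg) hD4 h18

/-- **THE U3 ROAD IN GUARDED ∀θ FORM**: the (D4) read-out binders at `(datumOfRecord₁₂ θ hP, u3OfRecord₁₂ θ (𝔯.lit F θ hP g₀ os).u3 k)` and NE5 at that bundle, for every
admissible tuple with provisos in the regime, every `g₀, os, k` — the right-hand sides of n22-e's `s_D4_rRec₁₂On_iff` ∕ `s_N18_rRec₁₂On_iff` — ⟹ `S_N17 (RRec₁₂On 𝔯 Rg)` (pointwise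
`YMDAG.N17.n17At_of_readOutAt`).  (D4) and NE5 UNPRINTED — binders. [cite: Balaban1987RG1, (1.20)-(1.22) p.264] -/
theorem s_N17_rRec₁₂On_of_readOut_ne5_forall_guarded
    (hD4 : ∀ (F : T4Family) (θ : Stage12Params F N) (hP : θ.Provisos₁₂ F N), Rg F θ → θ.Admissible F N →
      ∀ (g₀ : ℕ → ℝ) (os : List (ULoop F)) (k : ℕ), ReadOutAt (datumOfRecord₁₂ F N θ hP) (u3OfRecord₁₂ θ (𝔯.lit F θ hP g₀ os).u3 k))
    (h18 : ∀ (F : T4Family) (θ : Stage12Params F N) (hP : θ.Provisos₁₂ F N), Rg F θ → θ.Admissible F N →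
      ∀ (g₀ : ℕ → ℝ) (os : List (ULoop F)) (k : ℕ), N18At (u3OfRecord₁₂ θ (𝔯.lit F θ hP g₀ os).u3 k)) :
    S_N17 (RRec₁₂On 𝔯 Rg) :=
  (s_N17_rRec₁₂On_iff 𝔯 Rg).mpr fun F θ hP hRg hθ g₀ os k =>
    YMDAG.N17.n17At_of_readOutAt _ (hD4 F θ hP hRg hθ g₀ os k) (h18 F θ hP hRg hθ g₀ os k)

/-- **THE KERNEL ROAD IN GUARDED ∀θ FORM — N17 AT THE ON HOME END TO END IN KERNEL CURRENCY** (companion 13 `N17_datumOfRecord₁₂_of_kernelStepRate` on the record box of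
each tuple): for every admissible tuple with provisos in the regime, every `g₀, os`, with letters `u := (𝔯.lit F θ hP g₀ os).u3`, `0 ≤ u.ρ < 1`: (UD) — (5.10)-decay of the
record's OWN limiting polarisation kernels of the `(TcOfRecord, chiFixed7)` family on the boxes `]0, θ.γ]` — ∧ their HISTORY-MATCHED STEP RATE at rate `C′·u.ρ^k`, with
`betaPrime510 4 C′ δ′ ≤ u.cr·u.C₅·u.θ₅`, ∧ `Beta0LimitExists βmT(θ) θ.v₀` at coherent admissible reference histories ⟹ `S_N17 (RRec₁₂On 𝔯 Rg)`.  (UD) PRINTED for Bałaban's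
kernels, a hypothesis here; the step rate NOT PRINTED — rows NE2 ∕ NE3 ∕ NE5 (N15 ∕ N16 ∕ N18) in the record's letters. [cite: Balaban1987RG1, (1.21)-(1.22) p.264 and (5.10) p.293] -/
theorem s_N17_rRec₁₂On_of_kernelStepRate_forall_guarded
    (hin : ∀ (F : T4Family) (θ : Stage12Params F N) (hP : θ.Provisos₁₂ F N), Rg F θ → θ.Admissible F N → ∀ (g₀ : ℕ → ℝ) (os : List (ULoop F)),
      letI := θ.instVβ₁; letI := θ.instVβ₂; letI := θ.instιβ
      0 ≤ (𝔯.lit F θ hP g₀ os).u3.ρ ∧ (𝔯.lit F θ hP g₀ os).u3.ρ < 1 ∧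
      ∃ (C δ C' δ' : ℝ), 0 < δ ∧ 0 < δ' ∧
        betaPrime510 4 C' δ' ≤ (𝔯.lit F θ hP g₀ os).u3.cr * (𝔯.lit F θ hP g₀ os).u3.C₅ * (𝔯.lit F θ hP g₀ os).u3.θ₅ ∧
        (∀ k (v : Fin (k + 1) → ℝ), v ∈ Box θ.γ k →
          Decay510 (polLimit F (k + 1)
            (fun K => mergedTermFamilyMatT F N (TcOfRecord F N) (chiFixed7 F N θ.ν) θ.εbg k v K) θ.ρ8 θ.bV 0 1) C δ) ∧
        (∀ k (w : Fin (k + 2) → ℝ), w ∈ Box θ.γ (k + 1) →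
          Decay510 (subKernel
            (polLimit F (k + 1 + 1) (fun K => mergedTermFamilyMatT F N (TcOfRecord F N) (chiFixed7 F N θ.ν) θ.εbg (k + 1) w K) θ.ρ8 θ.bV)
            (polLimit F (k + 1) (fun K => mergedTermFamilyMatT F N (TcOfRecord F N) (chiFixed7 F N θ.ν) θ.εbg k (Fin.tail w) K) θ.ρ8 θ.bV)
              0 1) (C' * (𝔯.lit F θ hP g₀ os).u3.ρ ^ k) δ') ∧
        Beta0LimitExists (betaMerged F (mergedTermFamilyMatT F N (TcOfRecord F N) (chiFixed7 F N θ.ν) θ.εbg) θ.ρ8 θ.bV) θ.v₀ ∧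
        (∀ k, Fin.tail (θ.v₀ (k + 1)) = θ.v₀ k) ∧ (∀ k i, 0 < θ.v₀ k i ∧ θ.v₀ k i ≤ θ.γ)) :
    S_N17 (RRec₁₂On 𝔯 Rg) := by
  rw [s_N17_rRec₁₂On_iff]
  intro F θ hP hRg hθ g₀ os k
  letI := θ.instVβ₁; letI := θ.instVβ₂; letI := θ.instιβ
  obtain ⟨hρ0, hρ1, C, δ, C', δ', hδ, hδ', hcc, hU, hS, hlim, hcoh, hadm⟩ := hin F θ hP hRg hθ g₀ os
  have h17 := (N17_datumOfRecord₁₂_of_kernelStepRate θ hP le_rfl hθ.toStage9.gamma_pos hρ0 hρ1 hδ hδ' hU hS hlim hcoh hadm).1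
  rw [ne4OnData_iff] at h17
  rw [n17At_u3OfRecord₁₂_iff, ne4OnData_iff]
  exact scaleShiftRate_mono_const hcc hρ0 h17

/-- **WHAT THE STUB AT THE ON HOME DELIVERS AT EACH GUARDED TUPLE — ABOUT THE TUPLE's OWN ONE-LOOP NUMBERS** (the converse bookkeeping of the split road; companion 13
`content_of_N17_datumOfRecord₁₂` on the record box): `S_N17 (RRec₁₂On 𝔯 Rg)`, an admissible tuple `θ` with provisos in the regime, `g₀, os` with letters
`u := (𝔯.lit F θ hP g₀ os).u3`, `0 ≤ u.ρ < 1`, and the definer's one-sided limit `Beta0LimitExists βmT(θ) θ.v₀` at COHERENT reference histories with entries in `]0, θ.γ]` ⟹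
(AF-0r) `∃ β⁰_∞, |beta0OfMerged βmT(θ) θ.v₀ k − β⁰_∞| ≤ (u.cr·u.C₅·u.θ₅ ∕ (1 − u.ρ))·u.ρ^k` — K2′'s `hconv` input AT THE TUPLE (no canonical parameter) — AND the merged
remainder's scale-shift rate with constant `c + 2c∕(1 − ρ)`.  N15 ∕ N16-type outputs RETURNED by the composite, constants degraded by `1∕(1 − ρ)`. [cite: Balaban1987RG1, (2.12)-(2.14) p.268] -/
theorem af0r_of_s_N17_rRec₁₂On (hS : S_N17 (RRec₁₂On 𝔯 Rg)) {F : T4Family} (θ : Stage12Params F N) (hP : θ.Provisos₁₂ F N) (hRg : Rg F θ)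
    (hθ : θ.Admissible F N) (g₀ : ℕ → ℝ) (os : List (ULoop F)) (hρ0 : 0 ≤ (𝔯.lit F θ hP g₀ os).u3.ρ) (hρ1 : (𝔯.lit F θ hP g₀ os).u3.ρ < 1)
    (hlim : letI := θ.instVβ₁; letI := θ.instVβ₂; letI := θ.instιβ
      Beta0LimitExists (betaMerged F (mergedTermFamilyMatT F N (TcOfRecord F N) (chiFixed7 F N θ.ν) θ.εbg) θ.ρ8 θ.bV) θ.v₀)
    (hcoh : ∀ k, Fin.tail (θ.v₀ (k + 1)) = θ.v₀ k) (hadm : ∀ k i, 0 < θ.v₀ k i ∧ θ.v₀ k i ≤ θ.γ) :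
    letI := θ.instVβ₁; letI := θ.instVβ₂; letI := θ.instιβ
    (∃ binf : ℝ, ∀ k,
        |beta0OfMerged (betaMerged F (mergedTermFamilyMatT F N (TcOfRecord F N) (chiFixed7 F N θ.ν) θ.εbg) θ.ρ8 θ.bV) θ.v₀ k - binf| ≤
          (𝔯.lit F θ hP g₀ os).u3.cr * (𝔯.lit F θ hP g₀ os).u3.C₅ * (𝔯.lit F θ hP g₀ os).u3.θ₅ / (1 - (𝔯.lit F θ hP g₀ os).u3.ρ) *
            (𝔯.lit F θ hP g₀ os).u3.ρ ^ k) ∧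
      ScaleShiftRate
        ((𝔯.lit F θ hP g₀ os).u3.cr * (𝔯.lit F θ hP g₀ os).u3.C₅ * (𝔯.lit F θ hP g₀ os).u3.θ₅ +
          2 * ((𝔯.lit F θ hP g₀ os).u3.cr * (𝔯.lit F θ hP g₀ os).u3.C₅ * (𝔯.lit F θ hP g₀ os).u3.θ₅ / (1 - (𝔯.lit F θ hP g₀ os).u3.ρ)))
        (𝔯.lit F θ hP g₀ os).u3.ρ θ.γ (fun k w =>
        betaMerged F (mergedTermFamilyMatT F N (TcOfRecord F N) (chiFixed7 F N θ.ν) θ.εbg) θ.ρ8 θ.bV k w -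
          beta0OfMerged (betaMerged F (mergedTermFamilyMatT F N (TcOfRecord F N) (chiFixed7 F N θ.ν) θ.εbg) θ.ρ8 θ.bV) θ.v₀ k) := by
  letI := θ.instVβ₁; letI := θ.instVβ₂; letI := θ.instιβ
  exact content_of_N17_datumOfRecord₁₂ θ hP le_rfl hθ.toStage9.gamma_pos hρ0 hρ1 hlim hcoh hadm
    ((n17At_u3OfRecord₁₂_iff _ θ _ 0).mp ((s_N17_rRec₁₂On_iff 𝔯 Rg).mp hS F θ hP hRg hθ g₀ os 0))

/-! ## §57 TRANSFERS: antitone in the regime · to the canonical home · unity ⟹ guard of record · the vacuity face -/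

/-- **ANTITONE IN THE REGIME** (single-node cut of n22-e's `k4_rRec₁₂On_anti`): proved over a larger regime, the stub holds over every smaller one. [bookkeeping]
[cite: Balaban1987RG1, (1.20)-(1.22) p.264] -/
theorem s_N17_rRec₁₂On_anti {Rg Rg' : (F : T4Family) → Stage12Params F N → Prop} (h : ∀ F θ, Rg F θ → Rg' F θ) (hS : S_N17 (RRec₁₂On 𝔯 Rg')) :
    S_N17 (RRec₁₂On 𝔯 Rg) :=
  (k4_rRec₁₂On_anti 𝔯 h).2.2.2.1 hS

/-- **THE ON HOME AT THE TRIVIAL REGIME GIVES THE CANONICAL HOME `RRec₁₂ 𝔯`** (single-node cut of n22-e's `k4_rRec₁₂_of_rRec₁₂On_true`: the canonical parameter is one admissible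
tuple with provisos).  The converse is NOT claimed (N17 reads the tuple's `θ.γ` and the letters at the tuple). [bookkeeping] [cite: Balaban1987RG1, (1.20)-(1.22) p.264] -/
theorem s_N17_rRec₁₂_of_rRec₁₂On_true (hS : S_N17 (RRec₁₂On 𝔯 fun _ _ => True)) : S_N17 (RRec₁₂ 𝔯) :=
  (k4_rRec₁₂_of_rRec₁₂On_true 𝔯).2.2.2.1 hS

/-- … and the On home at any regime. [bookkeeping] [cite: Balaban1987RG1, (1.20)-(1.22) p.264] -/
theorem s_N17_rRec₁₂On_of_rRec₁₂On_true (hS : S_N17 (RRec₁₂On 𝔯 fun _ _ => True)) : S_N17 (RRec₁₂On 𝔯 Rg) :=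
  s_N17_rRec₁₂On_anti 𝔯 (fun _ _ _ => trivial) hS

/-- **THE ON HOME AT A REGIME CONTAINING EVERY CANONICAL PARAMETER GIVES THE CANONICAL HOME** (n22-e's `rRec₁₂On_of_regime_params`). [bookkeeping]
[cite: Balaban1987RG1, (1.20)-(1.22) p.264] -/
theorem s_N17_rRec₁₂_of_rRec₁₂On_of_regime_params (hreg : ∀ (F : T4Family) (D : Datum F N) (h : IsDatumOfRecord₁₂C F N D), Rg F h.params)
    (hS : S_N17 (RRec₁₂On 𝔯 Rg)) : S_N17 (RRec₁₂ 𝔯) :=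
  fun F D g₀ os R hR => hS F D g₀ os R (rRec₁₂On_of_regime_params 𝔯 Rg hreg hR)

/-- **THE UNITY REGIME GIVES THE GUARD OF RECORD** (director-ym LINE №99's partition-of-unity class ⊇ RR-2's `unityNondeg₁₂ N`): `S_N17` over `θ.ZtUnity F N` alone ⟹ n27-c's
`h17`. [bookkeeping] [cite: Balaban1987RG1, (1.20)-(1.22) p.264] -/
theorem s_N17_rRec₁₂On_unityNondeg_of_ztUnity (hS : S_N17 (RRec₁₂On 𝔯 fun F θ => θ.ZtUnity F N)) : S_N17 (RRec₁₂On 𝔯 (unityNondeg₁₂ N)) :=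
  s_N17_rRec₁₂On_anti 𝔯 (fun F θ h => ((unityNondeg₁₂_iff F N θ).mp h).1) hS

/-- **THE VACUITY FACE (R422 honesty)**: if NO family has an admissible Stage-12 tuple with provisos in the regime — the `Rg`-shadow of K0′ `Record12Inhabited` failing —
the stub at the On home holds vacuously.  Recorded so that a landing of `S_N17 (RRec₁₂On 𝔯 Rg)` is read together with the regime's inhabitation. [bookkeeping]
[cite: Balaban1987RG1, (1.20)-(1.22) p.264] -/
theorem s_N17_rRec₁₂On_of_guard_empty (hempty : ∀ (F : T4Family) (θ : Stage12Params F N), θ.Provisos₁₂ F N → Rg F θ → ¬ θ.Admissible F N) :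
    S_N17 (RRec₁₂On 𝔯 Rg) :=
  (s_N17_rRec₁₂On_iff 𝔯 Rg).mpr fun F θ hP hRg hθ => absurd hθ (hempty F θ hP hRg)

/-! ## §58 AT THE NAMED READING OF RECORD `readingOfRecord₁₂ w1 ℓ₃ ne2 ne1` (n22-e module 6): N17 reads W1's analytic-block letters at window radius `θ.γ` -/

section ReadingOfRecord

variable (w1 : (F : T4Family) → (θ : Stage12Params F N) → W1.ReadingData F (MatA N) θ.τ9.M) (ℓ₃ : T4Family → NE3Letters₁₁)
  (ne2 : (F : T4Family) → Stage12Params F N → (ℕ → ℝ) → List (ULoop F) → ℕ → NE2Objects₁₁)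
  (ne1 : (F : T4Family) → Stage12Params F N → (ℕ → ℝ) → List (ULoop F) → NE1pCarriers)

/-- **N17 AT ANY W1-ASSIGNMENT READING `RateReading₁₂.ofAssignment (W1.assignment₁₂ 𝔇) ne1`, REGIME-RESTRICTED HOME** (node00-def-W1's container `𝔇 : W1.AssignmentInputs₁₂ N`;
dag-n18-d's `𝔯_W1`, dag-n22-e module 7's home): the stub ⟺ for every admissible Stage-12 tuple with provisos in the regime, the `βmT(θ)` rate on `]0, θ.γ]` at the dependent letters
of W1's U3 objects `(𝔇.w1 F θ).u3Objects θ.γ` (`W1.assignment₁₂_u3`, `rfl`) — `g₀`, `os`, `𝔇.ne2`, `𝔇.ne3`, `ne1` IDLE. [cite: Balaban1987RG1, (1.20)-(1.22) p.264] -/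
theorem s_N17_rRec₁₂On_w1Assignment_iff_merged (𝔇 : W1.AssignmentInputs₁₂ N) :
    S_N17 (RRec₁₂On (RateReading₁₂.ofAssignment (W1.assignment₁₂ 𝔇) ne1) Rg) ↔
      ∀ (F : T4Family) (θ : Stage12Params F N), θ.Provisos₁₂ F N → Rg F θ → θ.Admissible F N →
        letI := θ.instVβ₁; letI := θ.instVβ₂; letI := θ.instιβ
        ScaleShiftRate (((𝔇.w1 F θ).u3Objects θ.γ).cr * ((𝔇.w1 F θ).u3Objects θ.γ).C₅ * ((𝔇.w1 F θ).u3Objects θ.γ).θ₅) ((𝔇.w1 F θ).u3Objects θ.γ).ρ θ.γ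
          (betaMerged F (mergedTermFamilyMatT F N (TcOfRecord F N) (chiFixed7 F N θ.ν) θ.εbg) θ.ρ8 θ.bV) := by
  rw [s_N17_rRec₁₂On_iff_merged]
  exact ⟨fun H F θ hP hRg hθ => H F θ hP hRg hθ (fun _ => 0) [], fun H F θ hP hRg hθ _ _ => H F θ hP hRg hθ⟩

/-- **N17 AT THE READING OF RECORD, REGIME-RESTRICTED HOME**: `S_N17 (RRec₁₂On (readingOfRecord₁₂ w1 ℓ₃ ne2 ne1) Rg)` ⟺ for every family, every admissible Stage-12 tuple with
provisos in the regime: the `βmT(θ)` rate on `]0, θ.γ]` at the dependent letters `(cr·C₅·θ₅, ρ)` of W1's U3 objects `(w1 F θ).u3Objects θ.γ` (`readingOfRecord₁₂_u3`, `rfl`) — ONE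
sentence per guarded tuple; `g₀`, `os`, `ne1`, `ne2`, `ℓ₃` IDLE.  W1's towers are residual DATA inside the named container. [cite: Balaban1987RG1, (1.20)-(1.22) p.264] -/
theorem s_N17_rRec₁₂On_readingOfRecord₁₂_iff_merged :
    S_N17 (RRec₁₂On (readingOfRecord₁₂ w1 ℓ₃ ne2 ne1) Rg) ↔
      ∀ (F : T4Family) (θ : Stage12Params F N), θ.Provisos₁₂ F N → Rg F θ → θ.Admissible F N →
        letI := θ.instVβ₁; letI := θ.instVβ₂; letI := θ.instιβ
        ScaleShiftRate (((w1 F θ).u3Objects θ.γ).cr * ((w1 F θ).u3Objects θ.γ).C₅ * ((w1 F θ).u3Objects θ.γ).θ₅) ((w1 F θ).u3Objects θ.γ).ρ θ.γ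
          (betaMerged F (mergedTermFamilyMatT F N (TcOfRecord F N) (chiFixed7 F N θ.ν) θ.εbg) θ.ρ8 θ.bV) := by
  rw [s_N17_rRec₁₂On_iff_merged]
  exact ⟨fun H F θ hP hRg hθ => H F θ hP hRg hθ (fun _ => 0) [], fun H F θ hP hRg hθ _ _ => H F θ hP hRg hθ⟩

/-- **… AND AT THE CANONICAL HOME OF THE READING OF RECORD** (companion 16 `s_N17_rRec₁₂_iff_merged` with the run inputs dropped; n22-e's `s_N17_readingOfRecord₁₂_iff` with the
run length eliminated and the β named): `S_N17 (RRec₁₂ (readingOfRecord₁₂ …))` ⟺ at every Stage-12 datum key, the `βmT(h.params)` rate at W1's letters at `h.params`.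
[cite: Balaban1987RG1, (1.20)-(1.22) p.264] -/
theorem s_N17_readingOfRecord₁₂_iff_merged :
    S_N17 (RRec₁₂ (readingOfRecord₁₂ w1 ℓ₃ ne2 ne1)) ↔
      ∀ (F : T4Family) (D : Datum F N) (h : IsDatumOfRecord₁₂C F N D),
        letI := h.params.instVβ₁; letI := h.params.instVβ₂; letI := h.params.instιβ
        ScaleShiftRate
          (((w1 F h.params).u3Objects h.params.γ).cr * ((w1 F h.params).u3Objects h.params.γ).C₅ * ((w1 F h.params).u3Objects h.params.γ).θ₅)
          ((w1 F h.params).u3Objects h.params.γ).ρ h.params.γ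
          (betaMerged F (mergedTermFamilyMatT F N (TcOfRecord F N) (chiFixed7 F N h.params.ν) h.params.εbg) h.params.ρ8 h.params.bV) := by
  rw [s_N17_rRec₁₂_iff_merged]
  exact ⟨fun H F D h => H F D h (fun _ => 0) [], fun H F D h _ _ => H F D h⟩

end ReadingOfRecord

/-! ## §59 N17's ∀-FORM AT node00-def-RR-2's REGIME RECORD CLASSES `IsRecordOfRecord₁₂COn F N Rg` ∕ `IsRecordOfRecord₁₂CN F N` (the estimate asked only IN THE REGIME) -/

section RegimeRecords

variable {Rg}

/-- **N17 AT A STAGE-12 RECORD `(D, w)` REALISED IN THE REGIME.**  If at EVERY admissible Stage-12 tuple with provisos IN `Rg` whose datum is `D` and whose record box contains the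
world's window the continuous-version merged β `βmT(θ)` satisfies `ScaleShiftRate cN ρ w.γ`, then `NE4OnData D cN ρ w.γ` — companion 13's `N17_of_isRecordOfRecord₁₂C` with the
regime available to the estimate (the key's tuple `IsRateKey₁₂ F N D w θ` lies in `Rg`; companion 15 `N17_iff_of_isRateKey₁₂`).  Hypothesis displayed, not asserted.
[cite: Balaban1987RG1, (1.20)-(1.22) p.264; Balaban1989LargeFieldII, Thm 1 p.355] -/
theorem N17_of_isRecordOfRecord₁₂COn {D : Datum F N} {w : WorldP} (h : IsRecordOfRecord₁₂COn F N Rg D w) {cN ρ : ℝ}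
    (hin : ∀ (θ : Stage12Params F N) (hP : θ.Provisos₁₂ F N), Rg F θ → θ.Admissible F N → D = datumOfRecord₁₂ F N θ hP → w.γ ≤ θ.γ →
      letI := θ.instVβ₁; letI := θ.instVβ₂; letI := θ.instιβ
      ScaleShiftRate cN ρ w.γ (betaMerged F (mergedTermFamilyMatT F N (TcOfRecord F N) (chiFixed7 F N θ.ν) θ.εbg) θ.ρ8 θ.bV)) :
    NE4OnData D cN ρ w.γ := by
  obtain ⟨θ, hRg, hk⟩ := h
  obtain ⟨hP, hθ, hD⟩ := hk.exists_provisos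
  exact (N17_iff_of_isRateKey₁₂ hk cN ρ).mpr (hin θ hP hRg hθ hD hk.gamma_le)

/-- **… as an `iff`**: at a record realised in the regime, `NE4OnData D cN ρ w.γ` ⟺ the `βmT(θ)` rate on the world's window at EVERY admissible tuple with provisos in the
regime realising `D` with `w.γ ≤ θ.γ` (⇒: companion 13 `N17_datumOfRecord₁₂_iff_merged` at each such tuple — the regime is not even needed that way). [bookkeeping]
[cite: Balaban1987RG1, (1.20)-(1.22) p.264] -/
theorem N17_iff_forall_of_isRecordOfRecord₁₂COn {D : Datum F N} {w : WorldP} (h : IsRecordOfRecord₁₂COn F N Rg D w) (cN ρ : ℝ) :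
    NE4OnData D cN ρ w.γ ↔
      ∀ (θ : Stage12Params F N) (hP : θ.Provisos₁₂ F N), Rg F θ → θ.Admissible F N → D = datumOfRecord₁₂ F N θ hP → w.γ ≤ θ.γ →
        letI := θ.instVβ₁; letI := θ.instVβ₂; letI := θ.instιβ
        ScaleShiftRate cN ρ w.γ (betaMerged F (mergedTermFamilyMatT F N (TcOfRecord F N) (chiFixed7 F N θ.ν) θ.εbg) θ.ρ8 θ.bV) := by
  refine ⟨fun hN θ hP _ _ hD hγ => ?_, N17_of_isRecordOfRecord₁₂COn h⟩
  subst hD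
  exact (N17_datumOfRecord₁₂_iff_merged θ hP hγ).mp hN

/-- **N17 AT A RECORD OF RR-2's CN CLASS** (the guard of record `θ.ZtUnity F N ∧ θ.SlotsNondegenerate`; `IsRecordOfRecord₁₂CN` = `IsRecordOfRecord₁₂COn … (unityNondeg₁₂ N)`): the
`βmT(θ)` rate asked only of the guarded admissible tuples with provisos realising `D`. [cite: Balaban1987RG1, (1.20)-(1.22) p.264; Balaban1988Convergent, (3.16)-(3.22) pp.268-269] -/
theorem N17_of_isRecordOfRecord₁₂CN {D : Datum F N} {w : WorldP} (h : IsRecordOfRecord₁₂CN F N D w) {cN ρ : ℝ}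
    (hin : ∀ (θ : Stage12Params F N) (hP : θ.Provisos₁₂ F N), θ.ZtUnity F N ∧ θ.SlotsNondegenerate → θ.Admissible F N → D = datumOfRecord₁₂ F N θ hP →
      w.γ ≤ θ.γ →
      letI := θ.instVβ₁; letI := θ.instVβ₂; letI := θ.instιβ
      ScaleShiftRate cN ρ w.γ (betaMerged F (mergedTermFamilyMatT F N (TcOfRecord F N) (chiFixed7 F N θ.ν) θ.εbg) θ.ρ8 θ.bV)) :
    NE4OnData D cN ρ w.γ :=
  N17_of_isRecordOfRecord₁₂COn h hin

/-- **(W2) CLOSER FOR AN `RRec` HOME KEYED TO THE REGIME RECORD CLASS**: if every bundle `R` of record for `(F, D, g₀, os)` comes with a world `w` making `(D, w)` a Stage-12 record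
REALISED IN THE REGIME whose window IS node U3's box (`R.u3.γ = w.γ`), and the `βmT(θ)` rate at `R.u3`'s letters is supplied in the guarded ∀-form above, then `S_N17 RRec` —
companion 13's `s_N17_of_rec₁₂C` with the regime available to the estimate. [cite: Balaban1987RG1, (1.20)-(1.22) p.264] -/
theorem s_N17_of_rec₁₂COn (RRec : RateRecordPred N)
    (hhome : ∀ (F : T4Family) (D : Datum F N) (g₀ : ℕ → ℝ) (os : List (ULoop F)) (R : RateCarriers N), RRec F D g₀ os R →
      ∃ w : WorldP, IsRecordOfRecord₁₂COn F N Rg D w ∧ R.u3.γ = w.γ)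
    (hin : ∀ (F : T4Family) (D : Datum F N) (g₀ : ℕ → ℝ) (os : List (ULoop F)) (R : RateCarriers N), RRec F D g₀ os R →
      ∀ (θ : Stage12Params F N) (hP : θ.Provisos₁₂ F N), Rg F θ → θ.Admissible F N → D = datumOfRecord₁₂ F N θ hP → R.u3.γ ≤ θ.γ →
        letI := θ.instVβ₁; letI := θ.instVβ₂; letI := θ.instιβ
        ScaleShiftRate (R.u3.cr * R.u3.C₅ * R.u3.θ) R.u3.ρ R.u3.γ
          (betaMerged F (mergedTermFamilyMatT F N (TcOfRecord F N) (chiFixed7 F N θ.ν) θ.εbg) θ.ρ8 θ.bV)) :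
    S_N17 RRec := by
  intro F D g₀ os R hR
  obtain ⟨w, hw, hγ⟩ := hhome F D g₀ os R hR
  show NE4OnData D _ _ _
  rw [hγ]
  exact N17_of_isRecordOfRecord₁₂COn hw fun θ hP hRg hθ hD hle => hγ ▸ hin F D g₀ os R hR θ hP hRg hθ hD (hγ.le.trans hle)

end RegimeRecords

end Summit.QuantumFields.YangMills.Theorems.BalabanUVNodesN17

end
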